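import Summits.RiemannHypothesis.RiemannHypothesis.Theorems.UniversalFactorLehmerNumerics

/-!
# RiemannHypothesis / UniversalFactor — the certified box for `lehmerF t₀ κ (½ + it)`

Route `RiemannHypothesis/UniversalFactor`, item `LehmerPointNoGo` (stmt-RiemannHypothesis-2582).

* `UniversalFactor.LCtx` — evaluation context (the `ζ`-tables of `ZetaCertifiedEvaluation.lean`,
  `t₀ = t0N/t0D`, enclosures of `log π`, `thetaMain t₀`, `Re/Im F(¼ + it₀/2)`), `UniversalFactor.mkCtx`,
  `UniversalFactor.LCtx.Valid`, `UniversalFactor.mkCtx_valid`;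
* `UniversalFactor.lehmerF_half_eq` — `lehmerF t₀ κ (½+it) = e^{iφ}(t²+¼)e^{x} ζ(½+it)` with explicit real
  `x`, `φ` (from `UniversalFactor.stirlingPrim_thetaArg`);
* `UniversalFactor.lehmerFBox` / `UniversalFactor.mem_lehmerFBox` — the box and its soundness
  (`MI.mem_exp`, `MC.mem_expI`, `mem_zetaBox`).

Everything is proved; the only numerical data are the evaluation parameters.
-/

set_option linter.dupNamespace false

namespace Summit.RiemannHypothesis.RiemannHypothesis.Theorems

open Complex Real Finset
open Literature.Analysis.ValidatedNumerics Literature.Analysis.ValidatedNumerics.NumericsMP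
open Literature.NumberTheory.LFunctions Literature.NumberTheory.LFunctions.ZetaNumerics
open Literature.Analysis.SpecialFunctions.Complex (stirlingPrim)

/-! ## The evaluation context at `t₀` -/

/-- Soundness of `mkCtx`: the fields of a validity certificate. [folklore] -/
theorem UniversalFactor.mkCtx_spec {T : Tables} (hT : T.Valid) {Klog t0N t0D : ℕ} {C : UniversalFactor.LCtx}
    (h : UniversalFactor.mkCtx T Klog t0N t0D = some C) :
    C.T.Valid ∧ 0 < C.t0D ∧ C.t0D ≤ C.t0N ∧ MI.mem C.T.S (Real.log π) C.logPi ∧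
      MI.mem C.T.S (UniversalFactor.thetaMain C.t0) C.theta0 ∧
      MI.mem C.T.S (UniversalFactor.reSPR C.t0) C.reSP0 ∧ MI.mem C.T.S (UniversalFactor.imSPR C.t0) C.imSP0 := by
  unfold UniversalFactor.mkCtx at h
  split_ifs at h with hd
  split at h
  · rename_i L2 LP LN LD P hL2 hLP hLN hLD hP
    simp only [Option.some.injEq] at h
    subst h
    have hS := hT.S_pos
    have hpi := hT.mem_pi
    have m2 := MI.mem_logTwo hS hL2
    have mX : MI.mem T.S (1 - Real.pi / 4) ((MI.ofInt T.S 1).sub (T.piI.divNat 4)) := by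
      have := MI.mem_sub (MI.mem_ofInt T.S 1) (MI.mem_divNat hpi (by norm_num : 0 < 4))
      simpa using this
    have mP := MI.mem_logOneSub hS hLP mX
    have hlogPi : MI.mem T.S (Real.log π) ((L2.mulInt 2).add LP) := by
      have := MI.mem_add (MI.mem_mulInt m2 2) mP
      convert this using 1
      rw [show (1 : ℝ) - (1 - Real.pi / 4) = Real.pi / 4 by ring, Real.log_div Real.pi_pos.ne' (by norm_num),
        show (4 : ℝ) = 2 ^ 2 by norm_num, Real.log_pow]
      push_cast; ring
    have mN := MI.mem_logNat hS hLN
    have mD := MI.mem_logNat hS hLD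
    have hsp := UniversalFactor.mem_spOf hS hpi hd.1 hd.2 hP
    have ht0 : MI.mem T.S ((t0N : ℝ) / t0D) (MI.ofFrac T.S t0N t0D) := by
      have := MI.mem_ofFrac T.S (t0N : ℤ) (q := t0D) hd.1
      simpa using this
    refine ⟨hT, hd.1, hd.2, hlogPi, ?_, hsp.1, hsp.2⟩
    have hDr : (0 : ℝ) < t0D := by exact_mod_cast hd.1
    have hNr : (0 : ℝ) < t0N := by exact_mod_cast (lt_of_lt_of_le hd.1 hd.2)
    have := MI.mem_sub (MI.mem_sub (MI.mem_mul hS (MI.mem_divNat ht0 (by norm_num : 0 < 2))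
      (MI.mem_sub (MI.mem_sub (MI.mem_sub mN mD) m2) hlogPi)) (MI.mem_divNat ht0 (by norm_num : 0 < 2)))
      (MI.mem_divNat hpi (by norm_num : 0 < 8))
    convert this using 1
    simp only [UniversalFactor.LCtx.t0, UniversalFactor.thetaMain]
    rw [Real.log_div (by positivity) (by positivity), Real.log_div hNr.ne' hDr.ne',
      Real.log_mul (by norm_num) Real.pi_pos.ne']
    push_cast
    ring
  · simp at h

/-! ## The box for `lehmerF t₀ κ (½ + it)` -/

/-- **The explicit factor on the critical line in real terms**: for `t, t₀ > 0` and real `κ`,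
`lehmerF t₀ κ (½ + it) = (e^{iφ} · (t² + ¼) · e^{x}) · ζ(½ + it)` with
`x = Re F(t) − Re F(t₀) − κ(t − t₀)`, `φ = thetaMain t₀ − ((t − t₀)/2) log π + Im F(t) − Im F(t₀)`
(`F(·) = stirlingPrim(¼ + i·/2)`). [folklore] -/
theorem UniversalFactor.lehmerF_half_eq {t₀ t : ℝ} (κ : ℝ) (ht₀ : 0 < t₀) (ht : 0 < t) :
    UniversalFactor.lehmerF t₀ κ (1 / 2 + t * I) =
      (cexp ((UniversalFactor.thetaMain t₀ - (t - t₀) / 2 * Real.log π + UniversalFactor.imSPR t -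
          UniversalFactor.imSPR t₀ : ℝ) * I) * ((t ^ 2 + 1 / 4 : ℝ) : ℂ) *
        ((Real.exp (UniversalFactor.reSPR t - UniversalFactor.reSPR t₀ - κ * (t - t₀)) : ℝ) : ℂ)) *
      riemannZeta (1 / 2 + t * I) := by
  unfold UniversalFactor.lehmerF UniversalFactor.lehmerCore
  rw [UniversalFactor.half_add_div_two, UniversalFactor.stirlingPrim_thetaArg ht,
    UniversalFactor.stirlingPrim_thetaArg ht₀, Complex.ofReal_exp]
  have hss : ((1 : ℂ) / 2 + t * I) * (1 - (1 / 2 + t * I)) = ((t ^ 2 + 1 / 4 : ℝ) : ℂ) := by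
    push_cast; ring_nf; rw [Complex.I_sq]; ring
  rw [hss]
  have key : cexp (UniversalFactor.thetaMain t₀ * I) * cexp (-(((1 : ℂ) / 2 + t * I - (1 / 2 + t₀ * I)) / 2) * (Real.log π : ℂ)) *
      cexp (((UniversalFactor.reSPR t : ℝ) : ℂ) + ((UniversalFactor.imSPR t : ℝ) : ℂ) * I -
        (((UniversalFactor.reSPR t₀ : ℝ) : ℂ) + ((UniversalFactor.imSPR t₀ : ℝ) : ℂ) * I)) *
      cexp (κ * I * ((1 : ℂ) / 2 + t * I - (1 / 2 + t₀ * I))) =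
      cexp ((UniversalFactor.thetaMain t₀ - (t - t₀) / 2 * Real.log π + UniversalFactor.imSPR t -
          UniversalFactor.imSPR t₀ : ℝ) * I) *
        cexp ((UniversalFactor.reSPR t - UniversalFactor.reSPR t₀ - κ * (t - t₀) : ℝ) : ℂ) := by
    rw [← Complex.exp_add, ← Complex.exp_add, ← Complex.exp_add, ← Complex.exp_add]
    congr 1
    push_cast
    ring_nf
    rw [Complex.I_sq]
    ring
  linear_combination ((t ^ 2 + 1 / 4 : ℝ) : ℂ) * riemannZeta (1 / 2 + t * I) * key

/-- **Soundness of `lehmerFBox`.** [folklore] -/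
theorem UniversalFactor.mem_lehmerFBox {C : UniversalFactor.LCtx} (hC : C.Valid) {a b : ℕ} (hb : 0 < b)
    (hba : b ≤ a) {κ : ℤ} {F : MC} (h : UniversalFactor.lehmerFBox C a b κ = some F) :
    MC.mem C.T.S (UniversalFactor.lehmerF C.t0 κ (1 / 2 + (((a : ℝ) / b : ℝ) : ℂ) * I)) F := by
  have hS := hC.tv.S_pos
  have hpi := hC.tv.mem_pi
  unfold UniversalFactor.lehmerFBox at h
  simp only at h
  split at h
  · rename_i Z P hZ hP
    split at h
    · rename_i E U hE hU
      simp only [Option.some.injEq] at h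
      subst h
      set t : ℝ := (a : ℝ) / b with ht
      have hbr : (0 : ℝ) < b := by exact_mod_cast hb
      have har : (0 : ℝ) < a := by exact_mod_cast (lt_of_lt_of_le hb hba)
      have htpos : 0 < t := by positivity
      have ht1 : 1 ≤ t := by rw [ht, le_div_iff₀ hbr, one_mul]; exact_mod_cast hba
      have ht0pos : 0 < C.t0 := by
        unfold UniversalFactor.LCtx.t0
        have := hC.t0D_pos; have := hC.t0D_le
        have h1 : (0:ℝ) < C.t0D := by exact_mod_cast hC.t0D_pos
        have h2 : (0:ℝ) < C.t0N := by exact_mod_cast (lt_of_lt_of_le hC.t0D_pos hC.t0D_le)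
        positivity
      -- memberships of the pieces
      have mt : MI.mem C.T.S t (MI.ofFrac C.T.S a b) := by
        have := MI.mem_ofFrac C.T.S (a : ℤ) (q := b) hb; simpa [ht] using this
      have mt0 : MI.mem C.T.S C.t0 (MI.ofFrac C.T.S C.t0N C.t0D) := by
        have := MI.mem_ofFrac C.T.S (C.t0N : ℤ) (q := C.t0D) hC.t0D_pos
        simpa [UniversalFactor.LCtx.t0] using this
      have mdt := MI.mem_sub mt mt0
      have msp := UniversalFactor.mem_spOf hS hpi hb hba hP
      rw [← ht] at msp
      have mmag : MI.mem C.T.S (t ^ 2 + 1 / 4) (MI.ofFrac C.T.S (4 * (a : ℤ) ^ 2 + (b : ℤ) ^ 2) (4 * b ^ 2)) := by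
        have := MI.mem_ofFrac C.T.S (4 * (a : ℤ) ^ 2 + (b : ℤ) ^ 2) (q := 4 * b ^ 2) (by positivity)
        convert this using 1
        rw [ht]; push_cast; field_simp
      have mex : MI.mem C.T.S (UniversalFactor.reSPR t - UniversalFactor.reSPR C.t0 - κ * (t - C.t0))
          ((P.1.sub C.reSP0).sub ((MI.ofFrac C.T.S a b |>.sub (MI.ofFrac C.T.S C.t0N C.t0D)).mulInt κ)) := by
        have := MI.mem_sub (MI.mem_sub msp.1 hC.mem_reSP0) (MI.mem_mulInt mdt κ)
        convert this using 1; ring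
      have mph : MI.mem C.T.S (UniversalFactor.thetaMain C.t0 - (t - C.t0) / 2 * Real.log π +
          UniversalFactor.imSPR t - UniversalFactor.imSPR C.t0)
          (((C.theta0.sub (MI.mul C.T.S ((MI.ofFrac C.T.S a b |>.sub (MI.ofFrac C.T.S C.t0N C.t0D)).divNat 2)
            C.logPi)).add P.2).sub C.imSP0) := by
        have := MI.mem_sub (MI.mem_add (MI.mem_sub hC.mem_theta0 (MI.mem_mul hS (MI.mem_divNat mdt
          (by norm_num : 0 < 2)) hC.mem_logPi)) msp.2) hC.mem_imSP0
        convert this using 1; push_cast; ring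
      have mE := MI.mem_exp hS hE mex
      have mU := MC.mem_expI hS hpi hU mph
      have hs1 : (1 : ℂ) / 2 + (t : ℂ) * I ≠ 1 := fun h => by
        have := congrArg Complex.im h; simp at this; linarith
      have ms : MC.mem C.T.S ((1 : ℂ) / 2 + (t : ℂ) * I) ⟨MI.ofFrac C.T.S 1 2, MI.ofFrac C.T.S a b⟩ := by
        refine ⟨?_, ?_⟩
        · have := MI.mem_ofFrac C.T.S (1 : ℤ) (q := 2) (by norm_num)
          simpa using this
        · simpa using mt
      have mZ := mem_zetaBox hC.tv ms hs1 hZ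
      have key := UniversalFactor.lehmerF_half_eq (κ : ℝ) ht0pos htpos
      rw [key]
      exact MC.mem_mul hS (MC.mem_mulMI hS (MC.mem_mulMI hS mU mmag) mE) mZ
    · simp at h
  · simp at h

end Summit.RiemannHypothesis.RiemannHypothesis.Theorems
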